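import Summits.ValiantsHypothesis.ValiantsHypothesis.Theorems.BarrierLeverTransversalMinorLayoutsEightFacesFrame

/-!
# Route BarrierLever — item `TransversalLayoutsRankLeEight` (stmt-ValiantsHypothesis-19933):
# eight faces without a vertex of degree one — solid triangle, four-path or three-star

Helper file (`--supports stmt-ValiantsHypothesis-19933`; cell valiant-natproofs, rung V4, 𝒟-side of
door (c); seat val-np-p1 gen 8).  `lowerFamily_eight_no_degree_one`: a lower family of exactly
eight sets in which no element lies in exactly one member is, in membership form, a SOLID TRIANGLE
(all members inside one `3`-set), a `4`-PATH `∅, v₁, v₂, v₃, v₄, v₁v₂, v₂v₃, v₃v₄` or a `3`-STAR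
`∅, v₀, v₁, v₂, v₃, v₀v₁, v₀v₂, v₀v₃`.  This is the partner classification for the locked cell
`(7, 8)` (partner of the `7`-claw).  The graph case uses the frame of `…EightFacesFrame` (pair member
`{a, b}`, outside singletons `{c}, {d}`, outside pairs `y, z`); the ten placements of `y, z`
give paths and stars.

WHAT THIS IS NOT: bookkeeping for a bounded-rank slice of TT; nothing on TT / item 19761 in
general, on crux stmt-ValiantsHypothesis-14610, or on `VP` versus `VNP`.
-/

-- layout Summits/ValiantsHypothesis/ValiantsHypothesis forces the duplicated namespace component
set_option linter.dupNamespace false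

open Matrix Finset

namespace Summit.ValiantsHypothesis.ValiantsHypothesis.Theorems.BarrierLever.FiniteCheck

open Summit.ValiantsHypothesis.ValiantsHypothesis.Theorems.BarrierLever.Compression

/-- A lower family of exactly eight sets in which no element lies in exactly one member: solid
triangle, four-path or three-star (membership form, with the memberships used downstream). -/
theorem lowerFamily_eight_no_degree_one {h : ℕ} (F : Finset (Finset (Fin h)))
    (hlow : ∀ x ∈ F, ∀ t, t ⊆ x → t ∈ F) (hF : F.card = 8)
    (hdeg : ∀ c : Fin h, (F.filter fun x => c ∈ x).card ≠ 1) :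
    (∃ a b c : Fin h, a ≠ b ∧ a ≠ c ∧ b ≠ c ∧ ∀ y ∈ F, y ⊆ {a, b, c}) ∨
    (∃ v₁ v₂ v₃ v₄ : Fin h, v₁ ≠ v₂ ∧ v₁ ≠ v₃ ∧ v₁ ≠ v₄ ∧ v₂ ≠ v₃ ∧ v₂ ≠ v₄ ∧ v₃ ≠ v₄ ∧
      ({v₁} : Finset (Fin h)) ∈ F ∧ ({v₂} : Finset (Fin h)) ∈ F ∧ ({v₁, v₂} : Finset (Fin h)) ∈ F ∧
      ({v₂, v₃} : Finset (Fin h)) ∈ F ∧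
      ∀ y ∈ F, y = ∅ ∨ y = {v₁} ∨ y = {v₂} ∨ y = {v₃} ∨ y = {v₄} ∨ y = {v₁, v₂} ∨ y = {v₂, v₃} ∨
        y = {v₃, v₄}) ∨
    (∃ v₀ v₁ v₂ v₃ : Fin h, v₀ ≠ v₁ ∧ v₀ ≠ v₂ ∧ v₀ ≠ v₃ ∧ v₁ ≠ v₂ ∧ v₁ ≠ v₃ ∧ v₂ ≠ v₃ ∧
      ({v₀} : Finset (Fin h)) ∈ F ∧ ({v₁} : Finset (Fin h)) ∈ F ∧ ({v₀, v₁} : Finset (Fin h)) ∈ F ∧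
      ({v₀, v₂} : Finset (Fin h)) ∈ F ∧ ({v₀, v₃} : Finset (Fin h)) ∈ F ∧
      ∀ y ∈ F, y = ∅ ∨ y = {v₀} ∨ y = {v₁} ∨ y = {v₂} ∨ y = {v₃} ∨ y = {v₀, v₁} ∨ y = {v₀, v₂} ∨
        y = {v₀, v₃}) := by
  classical
  by_cases hbig : ∃ x ∈ F, 3 ≤ x.card
  · obtain ⟨x, hx, hx3⟩ := hbig
    obtain ⟨S, hS3, hFS⟩ := eq_powerset_of_three_le_card F hlow (by omega) x hx hx3
    obtain ⟨a, b, c, hab, hac, hbc, rfl⟩ := Finset.card_eq_three.mp hS3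
    exact Or.inl ⟨a, b, c, hab, hac, hbc, fun y hy => by
      rw [hFS, Finset.mem_powerset] at hy; exact hy⟩
  right
  push Not at hbig
  have hle2 : ∀ x ∈ F, x.card ≤ 2 := fun x hx => by have := hbig x hx; omega
  obtain ⟨a, b, c, d, y, z, hab, hca, hcb, hda, hdb, hcd, hyz, haF, hbF, hxF, hcF, hdF, hyF, hzF,
    hmemF, hnorm, hshape, hcov⟩ := eight_no_degree_one_frame F hlow hF hdeg hle2
  -- the main case analysis, with `c ∈ y`
  have main : ∀ y z : Finset (Fin h), y ≠ z → y ∈ F → z ∈ F →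
      (∀ t, t ∈ F → t = ∅ ∨ t = {a} ∨ t = {b} ∨ t = {a, b} ∨ t = {c} ∨ t = {d} ∨ t = y ∨ t = z) →
      (∀ e₀ ∈ y, ∃ g : Fin h, g ≠ e₀ ∧ y = {e₀, g} ∧ (g = a ∨ g = b ∨ g = c ∨ g = d)) →
      (∀ e₀ ∈ z, ∃ g : Fin h, g ≠ e₀ ∧ z = {e₀, g} ∧ (g = a ∨ g = b ∨ g = c ∨ g = d)) →
      (∃ e f : Fin h, e ≠ f ∧ z = {e, f} ∧ (e = c ∨ e = d) ∧ (f = a ∨ f = b ∨ f = c ∨ f = d)) →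
      c ∈ y → (d ∈ y ∨ d ∈ z) →
      (∃ v₁ v₂ v₃ v₄ : Fin h, v₁ ≠ v₂ ∧ v₁ ≠ v₃ ∧ v₁ ≠ v₄ ∧ v₂ ≠ v₃ ∧ v₂ ≠ v₄ ∧ v₃ ≠ v₄ ∧
        ({v₁} : Finset (Fin h)) ∈ F ∧ ({v₂} : Finset (Fin h)) ∈ F ∧
        ({v₁, v₂} : Finset (Fin h)) ∈ F ∧ ({v₂, v₃} : Finset (Fin h)) ∈ F ∧
        ∀ y ∈ F, y = ∅ ∨ y = {v₁} ∨ y = {v₂} ∨ y = {v₃} ∨ y = {v₄} ∨ y = {v₁, v₂} ∨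
          y = {v₂, v₃} ∨ y = {v₃, v₄}) ∨
      (∃ v₀ v₁ v₂ v₃ : Fin h, v₀ ≠ v₁ ∧ v₀ ≠ v₂ ∧ v₀ ≠ v₃ ∧ v₁ ≠ v₂ ∧ v₁ ≠ v₃ ∧ v₂ ≠ v₃ ∧
        ({v₀} : Finset (Fin h)) ∈ F ∧ ({v₁} : Finset (Fin h)) ∈ F ∧
        ({v₀, v₁} : Finset (Fin h)) ∈ F ∧ ({v₀, v₂} : Finset (Fin h)) ∈ F ∧
        ({v₀, v₃} : Finset (Fin h)) ∈ F ∧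
        ∀ y ∈ F, y = ∅ ∨ y = {v₀} ∨ y = {v₁} ∨ y = {v₂} ∨ y = {v₃} ∨ y = {v₀, v₁} ∨
          y = {v₀, v₂} ∨ y = {v₀, v₃}) := by
    intro y z hyz hyF hzF hmem hny hnz hshz hcy hdyz
    have hbaF : ({b, a} : Finset (Fin h)) ∈ F := by rw [Finset.pair_comm]; exact hxF
    obtain ⟨g, hgc, hyeq, hg⟩ := hny c hcy
    rcases hg with hg | hg | hg | hg <;> rw [hg] at hyeq hgc
    · -- y = {c, a}; then d ∈ z and z = {d, g'}
      have hdz : d ∈ z := by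
        rcases hdyz with hdy | hdz
        · rw [hyeq, Finset.mem_insert, Finset.mem_singleton] at hdy
          rcases hdy with e | e
          · exact absurd e hcd.symm
          · exact absurd e hda
        · exact hdz
      obtain ⟨g', hg'd, hzeq, hg'⟩ := hnz d hdz
      rcases hg' with hg' | hg' | hg' | hg' <;> rw [hg'] at hzeq hg'd
      · -- z = {d, a}: star with centre a
        subst hyeq; subst hzeq
        right
        refine ⟨a, b, c, d, hab, hca.symm, hda.symm, hcb.symm, hdb.symm, hcd, haF, hbF, hxF, (by rw [Finset.pair_comm]; exact hyF), (by rw [Finset.pair_comm]; exact hzF),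
          fun t ht => ?_⟩
        rcases hmem t ht with rfl | rfl | rfl | rfl | rfl | rfl | rfl | rfl
        · exact Or.inl rfl
        · exact Or.inr (Or.inl rfl)
        · exact Or.inr (Or.inr (Or.inl rfl))
        · exact Or.inr (Or.inr (Or.inr (Or.inr (Or.inr (Or.inl rfl)))))
        · exact Or.inr (Or.inr (Or.inr (Or.inl rfl)))
        · exact Or.inr (Or.inr (Or.inr (Or.inr (Or.inl rfl))))
        · exact Or.inr (Or.inr (Or.inr (Or.inr (Or.inr (Or.inr (Or.inl (Finset.pair_comm _ _)))))))
        · exact Or.inr (Or.inr (Or.inr (Or.inr (Or.inr (Or.inr (Or.inr (Finset.pair_comm _ _)))))))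
      · -- z = {d, b}: path c - a - b - d
        subst hyeq; subst hzeq
        left
        refine ⟨c, a, b, d, hca, hcb, hcd, hab, hda.symm, hdb.symm, hcF, haF, hyF, hxF,
          fun t ht => ?_⟩
        rcases hmem t ht with rfl | rfl | rfl | rfl | rfl | rfl | rfl | rfl
        · exact Or.inl rfl
        · exact Or.inr (Or.inr (Or.inl rfl))
        · exact Or.inr (Or.inr (Or.inr (Or.inl rfl)))
        · exact Or.inr (Or.inr (Or.inr (Or.inr (Or.inr (Or.inr (Or.inl rfl))))))
        · exact Or.inr (Or.inl rfl)
        · exact Or.inr (Or.inr (Or.inr (Or.inr (Or.inl rfl))))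
        · exact Or.inr (Or.inr (Or.inr (Or.inr (Or.inr (Or.inl rfl)))))
        · exact Or.inr (Or.inr (Or.inr (Or.inr (Or.inr (Or.inr (Or.inr (Finset.pair_comm _ _)))))))
      · -- z = {d, c}: path b - a - c - d
        subst hyeq; subst hzeq
        left
        refine ⟨b, a, c, d, hab.symm, hcb.symm, hdb.symm, hca.symm, hda.symm, hcd, hbF, haF, hbaF, (by rw [Finset.pair_comm]; exact hyF),
          fun t ht => ?_⟩
        rcases hmem t ht with rfl | rfl | rfl | rfl | rfl | rfl | rfl | rfl
        · exact Or.inl rfl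
        · exact Or.inr (Or.inr (Or.inl rfl))
        · exact Or.inr (Or.inl rfl)
        · exact Or.inr (Or.inr (Or.inr (Or.inr (Or.inr (Or.inl (Finset.pair_comm _ _))))))
        · exact Or.inr (Or.inr (Or.inr (Or.inl rfl)))
        · exact Or.inr (Or.inr (Or.inr (Or.inr (Or.inl rfl))))
        · exact Or.inr (Or.inr (Or.inr (Or.inr (Or.inr (Or.inr (Or.inl (Finset.pair_comm _ _)))))))
        · exact Or.inr (Or.inr (Or.inr (Or.inr (Or.inr (Or.inr (Or.inr (Finset.pair_comm _ _)))))))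
      · exact absurd rfl hg'd
    · -- y = {c, b}; then d ∈ z
      have hdz : d ∈ z := by
        rcases hdyz with hdy | hdz
        · rw [hyeq, Finset.mem_insert, Finset.mem_singleton] at hdy
          rcases hdy with e | e
          · exact absurd e hcd.symm
          · exact absurd e hdb
        · exact hdz
      obtain ⟨g', hg'd, hzeq, hg'⟩ := hnz d hdz
      rcases hg' with hg' | hg' | hg' | hg' <;> rw [hg'] at hzeq hg'd
      · -- z = {d, a}: path c - b - a - d
        subst hyeq; subst hzeq
        left
        refine ⟨c, b, a, d, hcb, hca, hcd, hab.symm, hdb.symm, hda.symm, hcF, hbF, hyF, hbaF,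
          fun t ht => ?_⟩
        rcases hmem t ht with rfl | rfl | rfl | rfl | rfl | rfl | rfl | rfl
        · exact Or.inl rfl
        · exact Or.inr (Or.inr (Or.inr (Or.inl rfl)))
        · exact Or.inr (Or.inr (Or.inl rfl))
        · exact Or.inr (Or.inr (Or.inr (Or.inr (Or.inr (Or.inr (Or.inl (Finset.pair_comm _ _)))))))
        · exact Or.inr (Or.inl rfl)
        · exact Or.inr (Or.inr (Or.inr (Or.inr (Or.inl rfl))))
        · exact Or.inr (Or.inr (Or.inr (Or.inr (Or.inr (Or.inl rfl)))))
        · exact Or.inr (Or.inr (Or.inr (Or.inr (Or.inr (Or.inr (Or.inr (Finset.pair_comm _ _)))))))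
      · -- z = {d, b}: star with centre b
        subst hyeq; subst hzeq
        right
        refine ⟨b, a, c, d, hab.symm, hcb.symm, hdb.symm, hca.symm, hda.symm, hcd, hbF, haF, hbaF, (by rw [Finset.pair_comm]; exact hyF), (by rw [Finset.pair_comm]; exact hzF),
          fun t ht => ?_⟩
        rcases hmem t ht with rfl | rfl | rfl | rfl | rfl | rfl | rfl | rfl
        · exact Or.inl rfl
        · exact Or.inr (Or.inr (Or.inl rfl))
        · exact Or.inr (Or.inl rfl)
        · exact Or.inr (Or.inr (Or.inr (Or.inr (Or.inr (Or.inl (Finset.pair_comm _ _))))))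
        · exact Or.inr (Or.inr (Or.inr (Or.inl rfl)))
        · exact Or.inr (Or.inr (Or.inr (Or.inr (Or.inl rfl))))
        · exact Or.inr (Or.inr (Or.inr (Or.inr (Or.inr (Or.inr (Or.inl (Finset.pair_comm _ _)))))))
        · exact Or.inr (Or.inr (Or.inr (Or.inr (Or.inr (Or.inr (Or.inr (Finset.pair_comm _ _)))))))
      · -- z = {d, c}: path a - b - c - d
        subst hyeq; subst hzeq
        left
        refine ⟨a, b, c, d, hab, hca.symm, hda.symm, hcb.symm, hdb.symm, hcd, haF, hbF, hxF, (by rw [Finset.pair_comm]; exact hyF),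
          fun t ht => ?_⟩
        rcases hmem t ht with rfl | rfl | rfl | rfl | rfl | rfl | rfl | rfl
        · exact Or.inl rfl
        · exact Or.inr (Or.inl rfl)
        · exact Or.inr (Or.inr (Or.inl rfl))
        · exact Or.inr (Or.inr (Or.inr (Or.inr (Or.inr (Or.inl rfl)))))
        · exact Or.inr (Or.inr (Or.inr (Or.inl rfl)))
        · exact Or.inr (Or.inr (Or.inr (Or.inr (Or.inl rfl))))
        · exact Or.inr (Or.inr (Or.inr (Or.inr (Or.inr (Or.inr (Or.inl (Finset.pair_comm _ _)))))))
        · exact Or.inr (Or.inr (Or.inr (Or.inr (Or.inr (Or.inr (Or.inr (Finset.pair_comm _ _)))))))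
      · exact absurd rfl hg'd
    · exact absurd rfl hgc
    · -- y = {c, d}; z = {e', f'} with e' ∈ {c, d}, f' ∈ {a, b}
      obtain ⟨e', f', he'f', hzeq, he', hf'⟩ := hshz
      have hf'ab : f' = a ∨ f' = b := by
        rcases hf' with h1 | h1 | h1 | h1
        · exact Or.inl h1
        · exact Or.inr h1
        · exfalso
          rcases he' with h2 | h2
          · exact he'f' (h2.trans h1.symm)
          · apply hyz; rw [hyeq, hzeq, h1, h2, Finset.pair_comm]
        · exfalso
          rcases he' with h2 | h2
          · apply hyz; rw [hyeq, hzeq, h1, h2]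
          · exact he'f' (h2.trans h1.symm)
      rcases he' with he' | he' <;> rcases hf'ab with hf' | hf' <;> rw [he', hf'] at hzeq <;>
        subst hyeq <;> subst hzeq
      · -- z = {c, a}: path b - a - c - d
        left
        refine ⟨b, a, c, d, hab.symm, hcb.symm, hdb.symm, hca.symm, hda.symm, hcd, hbF, haF, hbaF, (by rw [Finset.pair_comm]; exact hzF),
          fun t ht => ?_⟩
        rcases hmem t ht with rfl | rfl | rfl | rfl | rfl | rfl | rfl | rfl
        · exact Or.inl rfl
        · exact Or.inr (Or.inr (Or.inl rfl))
        · exact Or.inr (Or.inl rfl)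
        · exact Or.inr (Or.inr (Or.inr (Or.inr (Or.inr (Or.inl (Finset.pair_comm _ _))))))
        · exact Or.inr (Or.inr (Or.inr (Or.inl rfl)))
        · exact Or.inr (Or.inr (Or.inr (Or.inr (Or.inl rfl))))
        · exact Or.inr (Or.inr (Or.inr (Or.inr (Or.inr (Or.inr (Or.inr (rfl)))))))
        · exact Or.inr (Or.inr (Or.inr (Or.inr (Or.inr (Or.inr (Or.inl (Finset.pair_comm _ _)))))))
      · -- z = {c, b}: path a - b - c - d
        left
        refine ⟨a, b, c, d, hab, hca.symm, hda.symm, hcb.symm, hdb.symm, hcd, haF, hbF, hxF, (by rw [Finset.pair_comm]; exact hzF),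
          fun t ht => ?_⟩
        rcases hmem t ht with rfl | rfl | rfl | rfl | rfl | rfl | rfl | rfl
        · exact Or.inl rfl
        · exact Or.inr (Or.inl rfl)
        · exact Or.inr (Or.inr (Or.inl rfl))
        · exact Or.inr (Or.inr (Or.inr (Or.inr (Or.inr (Or.inl rfl)))))
        · exact Or.inr (Or.inr (Or.inr (Or.inl rfl)))
        · exact Or.inr (Or.inr (Or.inr (Or.inr (Or.inl rfl))))
        · exact Or.inr (Or.inr (Or.inr (Or.inr (Or.inr (Or.inr (Or.inr (rfl)))))))
        · exact Or.inr (Or.inr (Or.inr (Or.inr (Or.inr (Or.inr (Or.inl (Finset.pair_comm _ _)))))))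
      · -- z = {d, a}: path b - a - d - c
        left
        refine ⟨b, a, d, c, hab.symm, hdb.symm, hcb.symm, hda.symm, hca.symm, hcd.symm, hbF, haF, hbaF, (by rw [Finset.pair_comm]; exact hzF),
          fun t ht => ?_⟩
        rcases hmem t ht with rfl | rfl | rfl | rfl | rfl | rfl | rfl | rfl
        · exact Or.inl rfl
        · exact Or.inr (Or.inr (Or.inl rfl))
        · exact Or.inr (Or.inl rfl)
        · exact Or.inr (Or.inr (Or.inr (Or.inr (Or.inr (Or.inl (Finset.pair_comm _ _))))))
        · exact Or.inr (Or.inr (Or.inr (Or.inr (Or.inl rfl))))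
        · exact Or.inr (Or.inr (Or.inr (Or.inl rfl)))
        · exact Or.inr (Or.inr (Or.inr (Or.inr (Or.inr (Or.inr (Or.inr (Finset.pair_comm _ _)))))))
        · exact Or.inr (Or.inr (Or.inr (Or.inr (Or.inr (Or.inr (Or.inl (Finset.pair_comm _ _)))))))
      · -- z = {d, b}: path a - b - d - c
        left
        refine ⟨a, b, d, c, hab, hda.symm, hca.symm, hdb.symm, hcb.symm, hcd.symm, haF, hbF, hxF, (by rw [Finset.pair_comm]; exact hzF),
          fun t ht => ?_⟩
        rcases hmem t ht with rfl | rfl | rfl | rfl | rfl | rfl | rfl | rfl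
        · exact Or.inl rfl
        · exact Or.inr (Or.inl rfl)
        · exact Or.inr (Or.inr (Or.inl rfl))
        · exact Or.inr (Or.inr (Or.inr (Or.inr (Or.inr (Or.inl rfl)))))
        · exact Or.inr (Or.inr (Or.inr (Or.inr (Or.inl rfl))))
        · exact Or.inr (Or.inr (Or.inr (Or.inl rfl)))
        · exact Or.inr (Or.inr (Or.inr (Or.inr (Or.inr (Or.inr (Or.inr (Finset.pair_comm _ _)))))))
        · exact Or.inr (Or.inr (Or.inr (Or.inr (Or.inr (Or.inr (Or.inl (Finset.pair_comm _ _)))))))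
  -- apply the main analysis with `c ∈ y` or, symmetrically, `c ∈ z`
  have hmem' : ∀ t, t ∈ F → t = ∅ ∨ t = {a} ∨ t = {b} ∨ t = {a, b} ∨ t = {c} ∨ t = {d} ∨
      t = z ∨ t = y := by
    intro t ht
    rcases hmemF t ht with e | e | e | e | e | e | e | e
    · exact Or.inl e
    · exact Or.inr (Or.inl e)
    · exact Or.inr (Or.inr (Or.inl e))
    · exact Or.inr (Or.inr (Or.inr (Or.inl e)))
    · exact Or.inr (Or.inr (Or.inr (Or.inr (Or.inl e))))
    · exact Or.inr (Or.inr (Or.inr (Or.inr (Or.inr (Or.inl e)))))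
    · exact Or.inr (Or.inr (Or.inr (Or.inr (Or.inr (Or.inr (Or.inr e))))))
    · exact Or.inr (Or.inr (Or.inr (Or.inr (Or.inr (Or.inr (Or.inl e))))))
  rcases hcov c (Or.inl rfl) with hcy | hcz
  · exact main y z hyz hyF hzF hmemF (hnorm y (Or.inl rfl)) (hnorm z (Or.inr rfl))
      (hshape z (Or.inr rfl)) hcy (hcov d (Or.inr rfl))
  · exact main z y (fun e => hyz e.symm) hzF hyF hmem' (hnorm z (Or.inr rfl)) (hnorm y (Or.inl rfl))
      (hshape y (Or.inl rfl)) hcz ((hcov d (Or.inr rfl)).symm)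

end Summit.ValiantsHypothesis.ValiantsHypothesis.Theorems.BarrierLever.FiniteCheck
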